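import Summits.Ventures.QEC.Thresholds.ToricCodeDepolarizingKernelSymm
import Summits.Ventures.QEC.Thresholds.ToricCodeMWPMThresholds
import HarnessLib

/-!
# MWPM decoders at the current kernel decimals: `p_c^{MWPM} > .0355` (both sectors), `> .0532` (depolarizing),
# `> .0111` (`T` noisy rounds, space-time matching) — UNCONDITIONAL

Venture QEC, `Summits/Ventures/QEC/Thresholds/` (LADDER-QEC Q5 «toric/surface + MWPM»; qec-type-09 gen 4, item 09.MWPM;
continues `ToricCodeMWPMThresholds.lean`, whose decimals `.0348 / .0522 / .0110` came from the memory-10 / memory-8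
connective-constant certificates). qec-type-03's symmetry-reduced kernel certificates (`ToricCodeThresholdKernelSymm`,
`ToricCodeDepolarizingKernelSymm`: `μ(ℤ²) ≤ 2.7014`, `μ(ℤ³) ≤ 4.7599`) moved the minimum-weight decimals to
`.0355 / .0532 / .0111`; by `IsMatchingDecoder.isMinWeight` (Edmonds–Johnson, `MatchingDecoders.lean`) through the
bridges `ToricCode.isMinWeight_of_isMatchingDecoder_star / _plaq / _st` the same decimals hold for EVERY
minimum-weight-perfect-matching decoder family (any admissible link metric, tie-break, geodesics). All UNCONDITIONAL,
tier CERTIFIED (kernel), axioms standard, 0 facts; certified LOWER bounds on the threshold; no new constant.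

| theorem | statement |
|---|---|
| `toric_mwpm_threshold_kernelSymmK14`, `toric_mwpm_accuracyThreshold_gt_0355`, `toric_mwpm_decaysExponentially_0355` | `Z`-sector, perfect measurement, every MWPM family: `≥ p₀(2.7014)`, **`p_c > .0355`**, decay below |
| `toric_x_mwpm_accuracyThreshold_gt_0355` | `X`-sector (plaquette matching): `p_c > .0355` |
| `toric_depolarizing_mwpm_accuracyThreshold_gt_0532` | depolarizing, sector-wise MWPM: **`p_c > .0532`** |
| `phenom_mwpm_threshold_kernelZ3SymmK10`, `phenom_mwpm_accuracyThreshold_gt_0111`, `phenom_mwpm_decaysExponentially_0111` | `T(L)` noisy rounds (`q = p`, poly `T`), space-time MWPM: **`p_c > .0111`** |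

## References
* [DennisEtAl2002] E. Dennis, A. Kitaev, A. Landahl, J. Preskill, *Topological quantum memory*, J. Math. Phys. 43
  (2002) 4452–4505, arXiv:quant-ph/0110143, §4.4 p. 18, §5.1 p. 19, §5.3 eqs. (p_c_2d), (threshold_iso_num).
-/

namespace Summit.Ventures.QEC.Thresholds

open Filter Topology Finset
open Literature.InformationTheory.QuantumCodes
open Literature.InformationTheory.QuantumCodes.ToricCode
open Literature.Probability.RandomPlanarGeometry

/-- **Toric threshold `≥ p₀(2.7014)` for every MWPM decoder family** — UNCONDITIONAL, kernel (symmetry-reduced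
memory-14 certificate). [cite: DennisEtAl2002, §4.4 p. 18 and §5.3 eq. (threshold_2d)] -/
theorem toric_mwpm_threshold_kernelSymmK14 (m : (L : ℕ) → EdgeMetric (starEnds (L + 1)))
    {D : (L : ℕ) → ZDecoder (L + 1)} (hD : ∀ L, IsMatchingDecoder (m L) (D L)) :
    IsThresholdLowerBound (toricFailureFamily D) (thresholdValue 2.7014) :=
  toricThreshold_kernelSymmK14 fun L => isMinWeight_of_isMatchingDecoder_star (hD L)

/-- **`p_c^{MWPM} > .0355`** (perfect measurement, `Z`-sector) for every MWPM decoder family — UNCONDITIONAL, kernel.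
[cite: DennisEtAl2002, §4.4 p. 18 and §5.3 eq. (p_c_2d)] -/
theorem toric_mwpm_accuracyThreshold_gt_0355 (m : (L : ℕ) → EdgeMetric (starEnds (L + 1)))
    {D : (L : ℕ) → ZDecoder (L + 1)} (hD : ∀ L, IsMatchingDecoder (m L) (D L)) :
    (0.0355 : ℝ) < accuracyThreshold (toricFailureFamily D) :=
  accuracyThreshold_gt_0355 fun L => isMinWeight_of_isMatchingDecoder_star (hD L)

/-- **Exponential decay of the MWPM failure probability at every `0 ≤ p ≤ .0355`** — UNCONDITIONAL, kernel.
[cite: DennisEtAl2002, §5.3 eq. (fail_2d)] -/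
theorem toric_mwpm_decaysExponentially_0355 (m : (L : ℕ) → EdgeMetric (starEnds (L + 1)))
    {D : (L : ℕ) → ZDecoder (L + 1)} (hD : ∀ L, IsMatchingDecoder (m L) (D L)) {p : ℝ} (hp₀ : 0 ≤ p)
    (hpp : p ≤ 0.0355) : DecaysExponentially (toricFailureFamily D) p :=
  toric_decaysExponentially_0355 (fun L => isMinWeight_of_isMatchingDecoder_star (hD L)) hp₀ hpp

/-- **`p_c^X > .0355` for every MWPM decoder family of the plaquette syndrome** — UNCONDITIONAL, kernel.
[cite: DennisEtAl2002, §4.4 p. 18 and §5.3 eq. (p_c_2d)] -/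
theorem toric_x_mwpm_accuracyThreshold_gt_0355 (m : (L : ℕ) → EdgeMetric (plaqEnds (L + 1)))
    (DX : (L : ℕ) → Decoder (Syndrome (L + 1)) (Chain (L + 1))) (hDX : ∀ L, IsMatchingDecoder (m L) (DX L)) :
    (0.0355 : ℝ) < accuracyThreshold (xFailureFamily (fun L => toricCode (L + 1)) DX) :=
  toric_x_accuracyThreshold_gt_0355 DX fun L => isMinWeight_of_isMatchingDecoder_plaq (hDX L)

/-- **`p_c^depol > .0532` for sector-wise MWPM decoding of the toric code** — UNCONDITIONAL, kernel.
[cite: DennisEtAl2002, §4.1 and §5.3] -/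
theorem toric_depolarizing_mwpm_accuracyThreshold_gt_0532 (mX : (L : ℕ) → EdgeMetric (plaqEnds (L + 1)))
    (mZ : (L : ℕ) → EdgeMetric (starEnds (L + 1)))
    (DX : (L : ℕ) → Decoder (Syndrome (L + 1)) (Chain (L + 1))) (DZ : (L : ℕ) → ZDecoder (L + 1))
    (hDX : ∀ L, IsMatchingDecoder (mX L) (DX L)) (hDZ : ∀ L, IsMatchingDecoder (mZ L) (DZ L)) :
    (0.0532 : ℝ) < accuracyThreshold (depolarizingFailureFamily (fun L => toricCode (L + 1)) DX DZ) :=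
  toric_depolarizing_accuracyThreshold_gt_0532 DX DZ
    (fun L => isMinWeight_of_isMatchingDecoder_plaq (hDX L)) fun L => isMinWeight_of_isMatchingDecoder_star (hDZ L)

/-- **Phenomenological threshold `≥ p₀(4.7599)` for every space-time MWPM decoder family** (`q = p`, poly-bounded `T`) —
UNCONDITIONAL, kernel. [cite: DennisEtAl2002, §5.1 p. 19 and §5.3 eq. (threshold_iso_num)] -/
theorem phenom_mwpm_threshold_kernelZ3SymmK10 {T : ℕ → ℕ} (hT : IsPolyBounded T)
    (m : (L : ℕ) → EdgeMetric (stLinkEnds (L + 1) (T L))) {D : (L : ℕ) → STDecoder (L + 1) (T L)}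
    (hD : ∀ L, IsMatchingDecoder (m L) (D L)) :
    IsThresholdLowerBound (phenomFailureFamily T D) (thresholdValue 4.7599) :=
  phenomThreshold_kernelZ3SymmK10 hT fun L => isMinWeight_of_isMatchingDecoder_st (hD L)

/-- **`p_c^{MWPM} > .0111` under phenomenological noise** for every space-time MWPM family — UNCONDITIONAL, kernel.
[cite: DennisEtAl2002, §5.1 p. 19 and §5.3 eq. (threshold_iso_num)] -/
theorem phenom_mwpm_accuracyThreshold_gt_0111 {T : ℕ → ℕ} (hT : IsPolyBounded T)
    (m : (L : ℕ) → EdgeMetric (stLinkEnds (L + 1) (T L))) {D : (L : ℕ) → STDecoder (L + 1) (T L)}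
    (hD : ∀ L, IsMatchingDecoder (m L) (D L)) :
    (0.0111 : ℝ) < accuracyThreshold (phenomFailureFamily T D) :=
  phenom_accuracyThreshold_gt_0111_std hT fun L => isMinWeight_of_isMatchingDecoder_st (hD L)

/-- **Exponential decay at every `0 ≤ p ≤ .0111`** for space-time MWPM families — UNCONDITIONAL, kernel.
[cite: DennisEtAl2002, §5.3 eq. (fail_iso)] -/
theorem phenom_mwpm_decaysExponentially_0111 {T : ℕ → ℕ} (hT : IsPolyBounded T)
    (m : (L : ℕ) → EdgeMetric (stLinkEnds (L + 1) (T L))) {D : (L : ℕ) → STDecoder (L + 1) (T L)}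
    (hD : ∀ L, IsMatchingDecoder (m L) (D L)) {p : ℝ} (hp₀ : 0 ≤ p) (hpp : p ≤ 0.0111) :
    DecaysExponentially (phenomFailureFamily T D) p :=
  phenom_decaysExponentially_0111 hT (fun L => isMinWeight_of_isMatchingDecoder_st (hD L)) hp₀ hpp

end Summit.Ventures.QEC.Thresholds
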